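import Literature.MathematicalPhysics.QuantumFieldTheory.Balaban1983to89.B2Eq345TowerCubes
import Literature.MathematicalPhysics.QuantumFieldTheory.Balaban1983to89.B2Ineq342From346
import Literature.MathematicalPhysics.QuantumFieldTheory.Balaban1983to89.B1Ineq368BoxBound

/-!
# `Balaban1983to89.B2Eq342TowerRun` — T. Bałaban, *(Higgs)₂,₃ quantum fields in a finite volume. II. An upper bound*,
Commun. Math. Phys. **86** (1982) 555–594 [Balaban1982Higgs2], Sect. 3.C pp. 592–594: **r14's abstract carriers of (3.42),
`B2.Run` and `B2Sect3C.CData`, INSTANTIATED by the tower of regions CONSTRUCTED on the (Higgs)₂,₃ tori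
(`B2Eq243RegionsTower`) — the leaf `B2Sect3C.Bound352` ((3.52) for `|Λ₀^{(k)c}|`) and p23's two collar hypotheses
((3.52)-shape bounds for `|Λ₇^{(k−1)′} ∩ Λ₇^{(k)c}|`, `|Λ₅^{(k−1)′} ∩ Λ₅^{(k)c}|`) PROVED for that run, the inputs of p23's
sequence count DISCHARGED, hence (3.42) `B2.Ineq342With` END TO END for the constructed tower and the claim of Sect. 3.C
`B2.Claim342Printed` for the family of all constructed towers — given only the field-side (3.46) shape of `ζ″` and the
printed constants' conditions**

statement-level skeleton of published theorems with citation tags; proofs where landed; nothing here is a claim about the Yang–Mills mass gap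

PDF held: `paper:balaban1982-cmp86-higgs23-ii` (journal page = PDF page + 554); pp. 566 [PDF 12], 582 [PDF 28], 588 [PDF 34],
592–594 [PDF 38–40] through the verbatim transcriptions in r14's `B2`/`B2Sect3C`, p23's `B2Ineq342From346` and the typer's
`B2Eq243RegionsTower`/`B2Eq345TowerCubes` (renders `run/shared/lean/pub/pub-balaban/b2b-balaban-ref1/pages/1982-cmp86-higgs23-II/`).

CITATION HEADER (lean-in-tree rule).  lit-balaban typed skeleton (HOME `run/shared/lean/pub/lit-balaban/`), typer line
(concrete carriers), gen 10 — the junction announced in `B2Eq345TowerCubes` (*"Packaging a `B2.Run`/`B2Sect3C.CData` (r14)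
whose `Seq` ranges over the realizable region sequences … is left to the owner of the (3.42) chain"*) and in p23's
`B2Ineq342From346` HONEST SCOPE (a) (*"no concrete multi-scale region model is built here"*).  SKELETON rows served:
**B2.Eq3.47** (members (3.48)–(3.52): r14's leaf `B2Sect3C.Bound352` PROVED for the model instance `towerRun`, kind
«model-instance»), **B2.Eq3.42** ((3.42) `B2.Ineq342With` and the claim `B2.Claim342Printed` for the constructed towers),
B2.Eq2.43 (the summation index «admissible sequences» realized as the large-field data generating them).  Owners: r02 (B2 fold),
r14 (second reader, author of `B2`/`B2Sect3C`), p23 (`B2Ineq342From346`, `B2Ineq347SeqCount`); referee ref-4.  NOTHING of record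
is restated: the run and its data are DEFINED from the typer's constructions, and every estimate is r14's/p23's/gen 9's theorem
APPLIED (`card_compl_towerRegion_le_352_coverIn_rFn`, `ineq342_of_346_blocks`, `entropy_of_blocks` inside it,
`exponent_nonpos` inside that, `B1Ineq368BoxBound.card_site_zero_eq`).

THE SOURCE TEXT (pp. 592–594, verbatim in `B2`'s section docstring; the sentences this file turns into definitions).  p. 592:
*"it is sufficient to show that Σ_{Λ₀^{(0)},…,Λ₀^{(K−1)}} Π_{k=0}^{K−1} ζ″_{Λ₀^{(k)}} · exp(Σ_{k=0}^{K} O(1)(Lᵏε)^{κ₀}|Λ₇^{(k−1)′}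
∩ Λ₇^{(k)c}|) · exp(Σ_{k=0}^{K} O(1)|Λ₅^{(k−1)′} ∩ Λ₅^{(k)c}|) ≤ exp(O(1)|T_ε|). (3.42)  C. The Combinatorial Estimate. In
this section we will prove the inequality (3.42). The proof is purely combinatoric and model-independent."*  p. 566: *"Here
the word “admissible” means that the sets Λ₀^{(j)} have to satisfy all the conditions resulting from the construction."*
p. 593: *"The sets 𝒞_k, more exactly their numbers of elements |𝒞_k|, will be just these basic quantities and we will
express the other quantities with their help."*  p. 594: *"|Λ₀^{(k)c}| ≤ O(1) r(Lᵏε)^d (|𝒞₀| + … + |𝒞_k|). (3.52) …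
−Σ_{k=0}^{K−1}(c₀p(Lᵏε)² − O(1) r(Lᵏε)^{d+1})|𝒞_k| ≤ 0 (3.54) if 2p ≥ (d+1)r and ε₀ is sufficiently small. Thus from (3.47)
inequality (3.42) follows and this ends the proof of inequality (2.117)."* (v1.1 DOCFIX of the two quotations — second
reader r14 g9, SECONDREAD-B2 v16, pp. 593–594 re-read as images: v1 paraphrased the p. 593 sentence and spliced the
(3.54) proviso *"if 2p ≥ (d+1)r …"* after *"follows"*; in print the proviso qualifies (3.54).)  p. 588 (3.23): *"where
Λ₅^{(K)} = ∅."*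

DICTIONARY (print ↦ Lean).  the summation index of (3.42) ↦ `LFData P` = one finite large-field set `P^{(k)} ⊂ T₁^{(k)}`
per step `k < K` (§1; the admissible sequences are its image under the construction); `Λ_i^{(k)}` ↦ `lam Q s k i` (= gen 9's
`towerRegionF (dataOf s) (radius P Q) k i` for `k < K`, `∅` at `k = K` by (3.23)); `Λ_i^{(k−1)′}` ↦ `lamPrev Q s k i`
(`T₁` at `k = 0`, p15's `prime` after; `lamPrev_seven_eq_window`: it IS the construction's window); `r(Lᵐε)` ↦
`radius P Q m = B2.rFn Q.R Q.r (Lᵐε)`; the run of (3.42) ↦ `towerRun P Q F : B2.Run` (`ε, K, |T_ε|` of the lattice; `ζ″, C₇,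
C₅` the GIVEN field data `F : FieldData P`; the collar volumes read off `lam`/`lamPrev`); `|𝒞_l|, |Λ₀^{(k)c}|, |T₁^{(K)}|` ↦
`towerCData P Q F : B2Sect3C.CData (towerRun P Q F)` (`|𝒞_l|` = gen 9's `coverIn`, the (3.45) reading); the O(1) of (3.52)
for `Λ_i` ↦ `D352 P r i` (§3; `Du Q M i` as a function of `d, L, M, r` alone, §6); the family of (2.117)/(3.42) *"independent
of ε"* ↦ `fam Q M : ℝ → Instance Q M → B2.Run` (all tori with the construction's `d, L, M`; `ε, K, L′_μ` free).

WHAT THIS FILE PROVES (0 sorry; standard axioms; definitions with bodies + theorems; no `Prop`-valued definition).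
§1–§2 the carriers, with unfolding lemmas (`towerRun_vol7`, `towerCData_vol0c`, `epsK_towerRun`, …).
§3 **`bound352 : Bound352 Q (towerRun P Q F) (towerCData P Q F) (D352 P Q.r 0)`** — r14's typed leaf (3.52) PROVED for the
   run (`Lᴷε ≤ 1`, `R ≥ 1`, `r ≥ 0`, `L > 1`); **`collar7`**, **`collar5`** — p23's hypotheses `h7`, `h5` of
   `B2Ineq342From346.ineq342_of_346` PROVED for the run (`|Λ₇^{(k−1)′} ∩ Λ₇^{(k)c}| ≤ |Λ₇^{(k)c}| ≤ D₇ r(Lᵏε)^d Σ_{l≤k}|𝒞_l|`,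
   cell GAPS G-pv04-3 (ii)); `vol7_K_le`, `vol5_K_le`, `volTK_le_volT` (the `k = K` volumes and `|T₁^{(K)}| ≤ |T_ε|`).
§4 the sequence-count inputs: `data_subset_compl_lam`/`card_data_le_vol0c` (`P^{(k)} ⊂ Λ₀^{(k)c}`, p23's `hv` with `m = 1`),
   `card_site_mul_mesh_pow` (`|T₁^{(k)}|(Lᵏε)^d = |T₁^{(K)}|(Lᴷε)^d`, p23's `hN`).
§5 **`ineq342 : … → B2.Ineq342With Q (towerRun P Q F) (C₇ + C₅ + 1)`** — (3.42) END TO END for the constructed tower, the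
   remaining hypotheses being `ζ″ ≥ 0`, the (3.46) shape of `ζ″`, `R ≥ 1`, `r ≥ 2`, `κ₀ ≥ 0`, `C₇, C₅ ≥ 0`, `Lᴷε ≤ 1`, and the
   per-scale (3.54) condition.
§6 **`claim342 : … → B2.Claim342Printed Q (fam Q M)`** — THE CLAIM OF SECT. 3.C (decl of record of row B2.Eq3.42) for the
   family of all constructed towers, strict case `2p > (d+1)r`, given the (3.46) shape with a uniform `a₆` and uniform bounds
   `C₇, C₅` on the instances' O(1)'s; threshold `ε₁ = min{1, e^{1−x₀}}`, constant `C₇ + C₅ + 1`.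
HONEST SCOPE.  (a) INDEX: (3.42) prints the sum over admissible SEQUENCES; this run sums over the large-field DATA generating
them (p. 566's definition of «admissible» = realizable by the construction), a surjective and in general not injective
re-indexing — with `ζ″`, `C₇`, `C₅` GIVEN per datum exactly as `B2.Run` gives them per sequence; a consumer summing over
sequences with nonnegative summands constant on the fibres is dominated by this sum.  (b) `Λ_i^{(K)} = ∅` is the printed
convention (3.23); the `k = K` collar volumes are then `|Λ₇^{(K−1)′}|`, `|Λ₅^{(K−1)′}| ≤ |T₁^{(K)}|`, absorbed in `exp(O(1)|T₁^{(K)}|)`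
as on p. 593.  (c) CONSTANTS: the O(1) of (3.52) is gen 9's `((4·max(i+1,8)·S351·LM + 1)(1 + LM))^d` (points, not cubes; the
print's `(22·S351)^d` assumes `r ≫ LM`), uniform over the family because `d, L, M` are the construction's fixed integers
(p. 604); the sequence count is p23's with one site per block (`m = 1`, `θ = d + 1`: cruder than the print's count of unions of
large blocks, same shape); `R ≥ 1` (print: `R > R₀`), `r ≥ 2` (print (2.7): `r > 1`; p. 594 uses `r ≥ 2`, cell GAPS G-pv04-2),
strict `2p > (d+1)r` inherited from `B2Sect3C`/`B2Ineq342From346`.  (d) NOT touched: the field side — `ζ″_{Λ₀^{(k)}}` of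
(3.41) and its (3.46) bound stay hypotheses on the given `F.zeta` (r14's `B2Eq341Zeta.zeta341_le` proves the (3.46) shape for
every admissible-tuple dictionary; wiring it to `coverIn` needs the torus form of the `3^d` count (3.44)/(3.45), not done
here), and the unprinted leaf (3.47) is bypassed as in p23's chain.  (e) Value = the geometric/combinatorial half of Sect.
3.C closed in the kernel for the concrete model the series constructs; NOT summit progress.  Unit `lit-balaban-typer` gen 10
(literature-prover-lit-balaban-typer-g10-0); HOME/FILED.md records the proposal.
-/

noncomputable section

open scoped BigOperators

namespace Literature.MathematicalPhysics.QuantumFieldTheory.Balaban1983to89.B2Eq342TowerRun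

open B2Sect3C (CData Bound352 S351 one_le_S351)
open B2Eq243RegionsTower (towerRegion window window_zero window_succ not_mem_towerRegion_of_bad)
open B2Eq324NestedRegions (prime)
open B2Eq350TowerVolume (towerRegionF)
open B2Eq352TowerVolumeBound (coef352 one_le_rFn rFn_nonneg)
open B2Eq345TowerCubes (coverIn windowF card_compl_towerRegion_le_352_coverIn_rFn LM_pos coef352_nonneg)

variable {P : HiggsLattice.Params}

/-! ## §1 The index of the sums of (3.42): the large-field data of the steps, and the regions of the run -/

/-- **The summation index of (2.43)/(3.42) for the constructed tower**: the large-field data of the steps `1, …, K` — one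
finite set `P^{(k)} = B(P_v^{(k)}) ∪ Q_v^{(k)} ∪ R_v^{(k)} ∪ B(P_s^{(k)}) ∪ Q_s^{(k)} ∪ R_s^{(k)} ⊂ T₁^{(k)}` per step `k < K`
((2.7) p. 558, (2.55) p. 570) — from which the admissible sequences `Λ₀^{(0)}, …, Λ₀^{(K−1)}` of (2.43) are CONSTRUCTED
(`B2Eq243RegionsTower.towerRegion`); p. 566: *"the word “admissible” means that the sets Λ₀^{(j)} have to satisfy all the
conditions resulting from the construction"*.  A finite type. [cite: Balaban1982Higgs2, (2.43) p.566] -/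
abbrev LFData (P : HiggsLattice.Params) : Type := (k : Fin P.K) → Finset (HiggsLattice.Site P k)

/-- The data of a run extended by `∅` at the levels `≥ K` (the last step has no further large-field set: (3.23) p. 588
*"where Λ₅^{(K)} = ∅"* is implemented below by `lam … K i = ∅`, so the level-`K` entry is never read). [cite: Balaban1982Higgs2, (3.23) p.588] -/
def dataOf (s : LFData P) : (j : ℕ) → Finset (HiggsLattice.Site P j) :=
  fun j => if h : j < P.K then s ⟨j, h⟩ else ∅

/-- Below `K` the extended data is the data. [cite: Balaban1982Higgs2, (2.43) p.566] -/
theorem dataOf_of_lt (s : LFData P) {j : ℕ} (h : j < P.K) : dataOf s j = s ⟨j, h⟩ := dif_pos h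

/-- From `K` on the extended data is empty. [cite: Balaban1982Higgs2, (3.23) p.588] -/
theorem dataOf_of_not_lt (s : LFData P) {j : ℕ} (h : ¬ j < P.K) : dataOf s j = ∅ := dif_neg h

/-- **The radii `r(Lᵐε) = R(1 + log(Lᵐε)⁻¹)ʳ`** of (2.7) p. 558 in lattice units of `T₁^{(m)}` (`B2.rFn` at the mesh
`Lᵐε = P.mesh m` of the `m`-th lattice), for the constants `R, r` of `Q : B2.Params`. [cite: Balaban1982Higgs2, (2.7) p.558] -/
def radius (P : HiggsLattice.Params) (Q : B2.Params) (m : ℕ) : ℝ := B2.rFn Q.R Q.r ((P.L : ℝ) ^ m * P.ε)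

/-- `radius P Q m = r(P.mesh m)`. [cite: Balaban1982Higgs2, (2.7) p.558] -/
theorem radius_eq_rFn_mesh (Q : B2.Params) (m : ℕ) : radius P Q m = B2.rFn Q.R Q.r (P.mesh m) := rfl

/-- **`Λ_i^{(k)}` of the run** (`i = 0, …, 7`, `k = 0, …, K`): the constructed regions `B2Eq243RegionsTower.towerRegion` of
the data for `k < K`, and `∅` at `k = K` — (3.23) p. 588 *"where Λ₅^{(K)} = ∅"* (the last step has no small-field region;
p15's `B2Eq324NestedRegions.Tower.top`). [cite: Balaban1982Higgs2, (2.43) p.566, (3.23) p.588] -/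
def lam (Q : B2.Params) (s : LFData P) (k i : ℕ) : Finset (HiggsLattice.Site P k) :=
  if k < P.K then towerRegionF (dataOf s) (radius P Q) k i else ∅

/-- **`Λ_i^{(k−1)′}`** (the block image of the previous step's region in `T₁^{(k)}`, p15's `prime`), with the convention
`Λ_i^{(−1)′} = T₁` of the first step (whose restrictions live on the whole lattice, (2.4)–(2.6) p. 557).
[cite: Balaban1982Higgs2, (3.22) p.588, (2.55) p.570] -/
def lamPrev (Q : B2.Params) (s : LFData P) : (k : ℕ) → ℕ → Finset (HiggsLattice.Site P k)
  | 0, _ => Finset.univ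
  | k + 1, i => prime (lam Q s k i)

variable {Q : B2.Params} {s : LFData P}

/-- Below `K`, `Λ_i^{(k)}` is the constructed region. [cite: Balaban1982Higgs2, (2.43) p.566] -/
theorem lam_of_lt {k : ℕ} (h : k < P.K) (i : ℕ) : lam Q s k i = towerRegionF (dataOf s) (radius P Q) k i := if_pos h

/-- At and beyond `K`, `Λ_i^{(k)} = ∅` ((3.23)). [cite: Balaban1982Higgs2, (3.23) p.588] -/
theorem lam_of_not_lt {k : ℕ} (h : ¬ k < P.K) (i : ℕ) : lam Q s k i = (∅ : Finset (HiggsLattice.Site P k)) := if_neg h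

/-- `Λ_i^{(−1)′} = T₁`. [cite: Balaban1982Higgs2, (2.7) p.558] -/
theorem lamPrev_zero (i : ℕ) : lamPrev Q s 0 i = (Finset.univ : Finset (HiggsLattice.Site P 0)) := rfl

/-- `Λ_i^{(k)′} = (Λ_i^{(k)})′`. [cite: Balaban1982Higgs2, (3.22) p.588] -/
theorem lamPrev_succ (k i : ℕ) : lamPrev Q s (k + 1) i = prime (lam Q s k i) := rfl

/-- **Consistency with the construction's windows**: for `k ≤ K`, `Λ₇^{(k−1)′}` IS the window of step `k + 1`
(`B2Eq243RegionsTower.window`: `T₁` for `k = 0`, `(Λ₇^{(k−1)})′` after), inside which `Λ₀^{(k)}` is built (p. 570).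
[cite: Balaban1982Higgs2, (2.55) p.570] -/
theorem lamPrev_seven_eq_window {k : ℕ} (hk : k ≤ P.K) : lamPrev Q s k 7 = windowF (dataOf s) (radius P Q) k := by
  cases k with
  | zero => rfl
  | succ k =>
    rw [lamPrev_succ, lam_of_lt (Nat.lt_of_succ_le hk)]
    rfl

/-! ## §2 The run of (3.42) and its combinatorial data (r14's abstract carriers `B2.Run`, `B2Sect3C.CData` INSTANTIATED) -/

/-- **The field-theoretic data of (3.41)–(3.42) that Sect. 3.C treats as given**: `ζ″_{Λ₀^{(k)}}` of (3.41) per step and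
datum, and the two O(1)'s `C₇`, `C₅` of the left side of (3.42) (from (2.43), (2.13)–(2.14)).  Pure data, as in
`B2.Run`. [cite: Balaban1982Higgs2, (3.41)–(3.42) p.592] -/
structure FieldData (P : HiggsLattice.Params) where
  /-- `ζ″_{Λ₀^{(k)}}` of (3.41) as a function of the step `k` and of the large-field data. -/
  zeta : ℕ → LFData P → ℝ
  /-- the O(1) of the `Λ₇`-collar factor of (3.42). -/
  C₇ : ℝ
  /-- the O(1) of the `Λ₅`-collar factor of (3.42). -/
  C₅ : ℝ

/-- **The run of (3.42) of the constructed tower** (`B2.Run`): spacing `ε`, `K` steps, `|T_ε|`, the finite index type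
`LFData P` of §1, `ζ″` and `C₇, C₅` from the field data, and the collar volumes READ OFF THE CONSTRUCTION:
`|Λ₇^{(k−1)′} ∩ Λ₇^{(k)c}| = |lamPrev k 7 \ lam k 7|`, `|Λ₅^{(k−1)′} ∩ Λ₅^{(k)c}| = |lamPrev k 5 \ lam k 5|` (`k = 0, …, K`; at
`k = K` these are `|Λ₇^{(K−1)′}|`, `|Λ₅^{(K−1)′}|` by (3.23)). [cite: Balaban1982Higgs2, (3.42) p.592] -/
def towerRun (P : HiggsLattice.Params) (Q : B2.Params) (F : FieldData P) : B2.Run where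
  ε := P.ε
  K := P.K
  volT := Fintype.card (HiggsLattice.Site P 0)
  Seq := LFData P
  fin := inferInstance
  zeta := F.zeta
  vol7 := fun k s => (lamPrev Q s k 7 \ lam Q s k 7).card
  vol5 := fun k s => (lamPrev Q s k 5 \ lam Q s k 5).card
  C₇ := F.C₇
  C₅ := F.C₅

/-- **The combinatorial data of Sect. 3.C of the constructed tower** (`B2Sect3C.CData`): `|𝒞_l|` = the number of cubes
of `q_l^d` large blocks containing a large block of `Λ₇^{(l−1)′} ∩ Λ₀^{(l)c}` (`B2Eq345TowerCubes.coverIn`, the (3.45)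
reading), `|Λ₀^{(k)c}| = |(lam k 0)ᶜ|`, and `|T₁^{(K)}|`. [cite: Balaban1982Higgs2, (3.43)–(3.45) p.592, p.593] -/
def towerCData (P : HiggsLattice.Params) (Q : B2.Params) (F : FieldData P) : CData (towerRun P Q F) where
  nC := fun l (s : LFData P) => (coverIn (dataOf s) (radius P Q) l).card
  vol0c := fun k (s : LFData P) => ((lam Q s k 0)ᶜ).card
  volTK := Fintype.card (HiggsLattice.Site P P.K)

variable {F : FieldData P}

/-- Unfolding: the run's `ε` is the lattice spacing. [cite: Balaban1982Higgs2, (3.42) p.592] -/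
@[simp] theorem towerRun_ε : (towerRun P Q F).ε = P.ε := rfl
/-- Unfolding: the run's `K`. [cite: Balaban1982Higgs2, (3.42) p.592] -/
@[simp] theorem towerRun_K : (towerRun P Q F).K = P.K := rfl
/-- Unfolding: `|T_ε|`. [cite: Balaban1982Higgs2, (3.42) p.592] -/
@[simp] theorem towerRun_volT : (towerRun P Q F).volT = Fintype.card (HiggsLattice.Site P 0) := rfl
/-- Unfolding: `ζ″`. [cite: Balaban1982Higgs2, (3.41) p.592] -/
@[simp] theorem towerRun_zeta (k : ℕ) (s : LFData P) : (towerRun P Q F).zeta k s = F.zeta k s := rfl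
/-- Unfolding: `C₇`. [cite: Balaban1982Higgs2, (3.42) p.592] -/
@[simp] theorem towerRun_C₇ : (towerRun P Q F).C₇ = F.C₇ := rfl
/-- Unfolding: `C₅`. [cite: Balaban1982Higgs2, (3.42) p.592] -/
@[simp] theorem towerRun_C₅ : (towerRun P Q F).C₅ = F.C₅ := rfl
/-- Unfolding: `|Λ₇^{(k−1)′} ∩ Λ₇^{(k)c}|`. [cite: Balaban1982Higgs2, (3.42) p.592] -/
theorem towerRun_vol7 (k : ℕ) (s : LFData P) :
    (towerRun P Q F).vol7 k s = (lamPrev Q s k 7 \ lam Q s k 7).card := rfl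
/-- Unfolding: `|Λ₅^{(k−1)′} ∩ Λ₅^{(k)c}|`. [cite: Balaban1982Higgs2, (3.42) p.592] -/
theorem towerRun_vol5 (k : ℕ) (s : LFData P) :
    (towerRun P Q F).vol5 k s = (lamPrev Q s k 5 \ lam Q s k 5).card := rfl
/-- Unfolding: `|𝒞_l|`. [cite: Balaban1982Higgs2, (3.45) p.592] -/
theorem towerCData_nC (l : ℕ) (s : LFData P) :
    (towerCData P Q F).nC l s = (coverIn (dataOf s) (radius P Q) l).card := rfl
/-- Unfolding: `|Λ₀^{(k)c}|`. [cite: Balaban1982Higgs2, (3.47) p.593] -/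
theorem towerCData_vol0c (k : ℕ) (s : LFData P) :
    (towerCData P Q F).vol0c k s = ((lam Q s k 0)ᶜ).card := rfl
/-- Unfolding: `|T₁^{(K)}|`. [cite: Balaban1982Higgs2, (3.47) p.593] -/
@[simp] theorem towerCData_volTK : (towerCData P Q F).volTK = Fintype.card (HiggsLattice.Site P P.K) := rfl
/-- Unfolding: the scale `Lᵏε` of the run is the mesh of `T₁^{(k)}` when `Q.L = P.L`. [cite: Balaban1982Higgs2, p.582] -/
theorem epsK_towerRun (hL : Q.L = P.L) (k : ℕ) : B2Sect3C.epsK Q (towerRun P Q F) k = (P.L : ℝ) ^ k * P.ε := by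
  simp [B2Sect3C.epsK, hL]


/-! ## §3 (3.52) for `Λ₀^{(k)c}`, `Λ₇^{(k)c}`, `Λ₅^{(k)c}` of the run: r14's leaf `B2Sect3C.Bound352` and p23's two collar
hypotheses PROVED for the constructed tower -/

/-- **The O(1) of (3.52) for the region `Λ_i` of the constructed tower** — gen 9's `B2Eq352TowerVolumeBound.coef352`
(`4·max(i+1,8)·S351·LM + 1`, `S351` = the printed series of (3.51)) times the cube-rounding factor `1 + LM`, to the `d`-th
power: `D_i = ((4·max(i+1,8)·S351(L,r)·LM + 1)·(1 + LM))^d` (the print's `O(1) = (22·S351)^d` assumes `r(ε) ≫ LM`; cf.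
`B2Sect3C.bound352_of_350`). [cite: Balaban1982Higgs2, (3.52) p.594] -/
def D352 (P : HiggsLattice.Params) (r : ℝ) (i : ℕ) : ℝ :=
  (coef352 P (S351 (P.L : ℝ) r) i * (1 + (P.L : ℝ) * P.M)) ^ P.d

/-- `D_i ≥ 0`. [cite: Balaban1982Higgs2, (3.52) p.594] -/
theorem D352_nonneg (hL : 1 < (P.L : ℝ)) (r : ℝ) (i : ℕ) : 0 ≤ D352 P r i := by
  unfold D352
  have hS : 0 ≤ S351 (P.L : ℝ) r := zero_le_one.trans (one_le_S351 hL)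
  have h1 := coef352_nonneg (P := P) hS i
  have h2 := (LM_pos P).le
  positivity

/-- Below the stopping scale every mesh is `≤ 1`: `Lᵏε ≤ Lᴷε ≤ 1` for `k ≤ K`. [cite: Balaban1982Higgs2, p.582] -/
theorem mesh_le_one_of_le (hL : 1 ≤ (P.L : ℝ)) {k K : ℕ} (hk : k ≤ K) (hK1 : (P.L : ℝ) ^ K * P.ε ≤ 1) :
    (P.L : ℝ) ^ k * P.ε ≤ 1 :=
  le_trans (mul_le_mul_of_nonneg_right (pow_le_pow_right₀ hL hk) P.hε.le) hK1

/-- `r(Lᵏε) ≥ 1 > 0` below the stopping scale (`R ≥ 1`, `r ≥ 0`). [cite: Balaban1982Higgs2, (2.7) p.558] -/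
theorem radius_pos (hR : 1 ≤ Q.R) (hr : 0 ≤ Q.r) (hL : 1 < (P.L : ℝ)) {k : ℕ} (hkε : (P.L : ℝ) ^ k * P.ε ≤ 1) :
    0 < radius P Q k :=
  lt_of_lt_of_le zero_lt_one (one_le_rFn (by linarith) P.hε hR hr hkε)

/-- **(3.52) for every region of the run below `K`**: `|Λ_i^{(k)c}| ≤ D_i · r(Lᵏε)^d · (|𝒞₀| + … + |𝒞_k|)` for `k < K`,
`Lᵏε ≤ 1`, `R ≥ 1`, `r ≥ 0` — gen 9's `B2Eq345TowerCubes.card_compl_towerRegion_le_352_coverIn_rFn` in the run's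
vocabulary. [cite: Balaban1982Higgs2, (3.52) p.594] -/
theorem card_compl_lam_le (hR : 1 ≤ Q.R) (hr : 0 ≤ Q.r) (hL : 1 < (P.L : ℝ)) {k : ℕ} (hk : k < P.K)
    (hkε : (P.L : ℝ) ^ k * P.ε ≤ 1) (i : ℕ) :
    ((((lam Q s k i)ᶜ).card : ℕ) : ℝ) ≤ D352 P Q.r i * radius P Q k ^ P.d
      * ∑ l ∈ Finset.range (k + 1), ((coverIn (dataOf s) (radius P Q) l).card : ℝ) := by
  rw [lam_of_lt hk]
  have h := card_compl_towerRegion_le_352_coverIn_rFn (bad := dataOf s) P.hε hR hr hL hk.le hkε i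
  unfold D352 radius
  exact h

/-- The scale of the run at step `k` in r14's vocabulary is the radius argument: `r(epsK k) = radius k` and the `d`-th
powers agree, when `Q.L = P.L`, `Q.d = P.d`. [cite: Balaban1982Higgs2, (3.52) p.594] -/
theorem rFn_epsK_pow_eq (hd : Q.d = P.d) (hLQ : Q.L = P.L) (k : ℕ) :
    B2.rFn Q.R Q.r (B2Sect3C.epsK Q (towerRun P Q F) k) ^ Q.d = radius P Q k ^ P.d := by
  rw [epsK_towerRun hLQ, hd]
  rfl

/-- **r14's leaf `B2Sect3C.Bound352` ((3.52) for `|Λ₀^{(k)c}|`) PROVED for the run of the constructed tower**, with the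
explicit O(1) `D₀ = D352 P r 0`, for `Lᴷε ≤ 1` (the stopping rule with `ε₀ ≤ 1`), `R ≥ 1`, `r ≥ 0`, `L > 1`.
[cite: Balaban1982Higgs2, (3.52) p.594] -/
theorem bound352 (hd : Q.d = P.d) (hLQ : Q.L = P.L) (hR : 1 ≤ Q.R) (hr : 0 ≤ Q.r) (hL : 1 < (P.L : ℝ))
    (hK1 : (P.L : ℝ) ^ P.K * P.ε ≤ 1) :
    Bound352 Q (towerRun P Q F) (towerCData P Q F) (D352 P Q.r 0) := by
  intro s k hk
  have hk' : k < P.K := hk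
  have h := card_compl_lam_le (s := s) hR hr hL hk' (mesh_le_one_of_le hL.le hk'.le hK1) 0
  rw [rFn_epsK_pow_eq hd hLQ]
  exact h

/-- `|A \ B| ≤ |Bᶜ|`. [cite: Balaban1982Higgs2, (3.42) p.592] -/
theorem card_sdiff_le_card_compl {α : Type*} [Fintype α] [DecidableEq α] (A B : Finset α) :
    (A \ B).card ≤ (Bᶜ).card :=
  Finset.card_le_card fun _ hx => Finset.mem_compl.mpr (Finset.mem_sdiff.mp hx).2

/-- **The `Λ₇`-collar bound in the (3.52) shape, PROVED for the run**: `|Λ₇^{(k−1)′} ∩ Λ₇^{(k)c}| ≤ |Λ₇^{(k)c}| ≤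
D₇ · r(Lᵏε)^d · (|𝒞₀| + … + |𝒞_k|)` for `k < K` — p23's hypothesis `h7` of `B2Ineq342From346.ineq342_of_346` (cell GAPS
G-pv04-3 (ii): what the corridor construction gives for the collars). [cite: Balaban1982Higgs2, (3.52) p.594, (3.42) p.592] -/
theorem collar7 (hd : Q.d = P.d) (hLQ : Q.L = P.L) (hR : 1 ≤ Q.R) (hr : 0 ≤ Q.r) (hL : 1 < (P.L : ℝ))
    (hK1 : (P.L : ℝ) ^ P.K * P.ε ≤ 1) :
    ∀ (s : LFData P) (k : ℕ), k < (towerRun P Q F).K → ((towerRun P Q F).vol7 k s : ℝ)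
      ≤ D352 P Q.r 7 * B2.rFn Q.R Q.r (B2Sect3C.epsK Q (towerRun P Q F) k) ^ Q.d
        * ∑ j ∈ Finset.range (k + 1), ((towerCData P Q F).nC j s : ℝ) := by
  intro s k hk
  have hk' : k < P.K := hk
  have h := card_compl_lam_le (s := s) hR hr hL hk' (mesh_le_one_of_le hL.le hk'.le hK1) 7
  rw [rFn_epsK_pow_eq hd hLQ, towerRun_vol7]
  refine le_trans ?_ h
  exact_mod_cast card_sdiff_le_card_compl _ _

/-- **The `Λ₅`-collar bound in the (3.52) shape, PROVED for the run**: `|Λ₅^{(k−1)′} ∩ Λ₅^{(k)c}| ≤ |Λ₅^{(k)c}| ≤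
D₅ · r(Lᵏε)^d · (|𝒞₀| + … + |𝒞_k|)` for `k < K` (p23's hypothesis `h5`). [cite: Balaban1982Higgs2, (3.52) p.594, (3.42) p.592] -/
theorem collar5 (hd : Q.d = P.d) (hLQ : Q.L = P.L) (hR : 1 ≤ Q.R) (hr : 0 ≤ Q.r) (hL : 1 < (P.L : ℝ))
    (hK1 : (P.L : ℝ) ^ P.K * P.ε ≤ 1) :
    ∀ (s : LFData P) (k : ℕ), k < (towerRun P Q F).K → ((towerRun P Q F).vol5 k s : ℝ)
      ≤ D352 P Q.r 5 * B2.rFn Q.R Q.r (B2Sect3C.epsK Q (towerRun P Q F) k) ^ Q.d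
        * ∑ j ∈ Finset.range (k + 1), ((towerCData P Q F).nC j s : ℝ) := by
  intro s k hk
  have hk' : k < P.K := hk
  have h := card_compl_lam_le (s := s) hR hr hL hk' (mesh_le_one_of_le hL.le hk'.le hK1) 5
  rw [rFn_epsK_pow_eq hd hLQ, towerRun_vol5]
  refine le_trans ?_ h
  exact_mod_cast card_sdiff_le_card_compl _ _

/-- The `k = K` collar volumes are at most `|T₁^{(K)}|` (p. 593: *"The third exponent has the required form"* — the
`k = K` terms of (3.42) go into `exp(O(1)|T₁^{(K)}|)`; here `Λ₇^{(K)} = ∅` by (3.23), so the volume is `|Λ₇^{(K−1)′}|`).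
[cite: Balaban1982Higgs2, (3.47) p.593] -/
theorem vol7_K_le (s : LFData P) : (towerRun P Q F).vol7 (towerRun P Q F).K s ≤ (towerCData P Q F).volTK :=
  Finset.card_le_univ _

/-- The same for the `Λ₅`-collar at `k = K`. [cite: Balaban1982Higgs2, (3.47) p.593] -/
theorem vol5_K_le (s : LFData P) : (towerRun P Q F).vol5 (towerRun P Q F).K s ≤ (towerCData P Q F).volTK :=
  Finset.card_le_univ _

/-- `|T₁^{(K)}| ≤ |T_ε|` (`|T_ε| = L^{Kd}|T₁^{(K)}|`, part I (1.20)). [cite: Balaban1982Higgs2, (3.42) p.592] -/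
theorem volTK_le_volT : (towerCData P Q F).volTK ≤ (towerRun P Q F).volT := by
  rw [towerCData_volTK, towerRun_volT, B1Ineq368BoxBound.card_site_zero_eq (P := P) (le_refl P.K)]
  exact Nat.le_mul_of_pos_left _ (pow_pos P.hL _)

/-! ## §4 The inputs of p23's sequence count (`B2Ineq347SeqCount.entropy_of_blocks`) for the run: the data inject into
tuples of site sets, each datum lies in its own `Λ₀^{(k)c}`, and all the lattices `T₁^{(k)}` have the volume `|T_ε|` -/

/-- **The large-field points of step `k` lie in `Λ₀^{(k)c}`** (`r(Lᵏε) > 0`; `B2Eq243RegionsTower.not_mem_towerRegion_of_bad`).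
[cite: Balaban1982Higgs2, (2.7) p.558] -/
theorem data_subset_compl_lam (hk : ∀ k : Fin P.K, 0 < radius P Q k) (k : Fin P.K) : s k ⊆ (lam Q s k 0)ᶜ := by
  intro z hz
  rw [Finset.mem_compl, lam_of_lt k.isLt]
  have hz' : z ∈ ((dataOf s k : Finset (HiggsLattice.Site P k)) : Set (HiggsLattice.Site P k)) := by
    rw [dataOf_of_lt s k.isLt]
    exact_mod_cast hz
  exact not_mem_towerRegion_of_bad (bad := fun j => (↑(dataOf s j) : Set (HiggsLattice.Site P j))) (hk k) 0 hz'

/-- Hence `|P^{(k)}| ≤ |Λ₀^{(k)c}|` — p23's `hv` with one site per "block" (`m = 1`). [cite: Balaban1982Higgs2, (3.47) p.593] -/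
theorem card_data_le_vol0c (hk : ∀ k : Fin P.K, 0 < radius P Q k) (s : LFData P) (k : Fin P.K) :
    (1 : ℝ) * ((s k).card : ℝ) ≤ ((towerCData P Q F).vol0c k s : ℝ) := by
  rw [one_mul, towerCData_vol0c]
  exact_mod_cast Finset.card_le_card (data_subset_compl_lam hk k)

/-- **All the lattices have the volume of the torus**: `|T₁^{(k)}|·(Lᵏε)^d = |T₁^{(K)}|·(Lᴷε)^d` (`= |T_ε|`, part I (1.21);
`B1Ineq368BoxBound.card_site_zero_eq`) — p23's `hN` with `m = 1`. [cite: Balaban1982Higgs2, (3.42) p.592] -/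
theorem card_site_mul_mesh_pow {k : ℕ} (hk : k ≤ P.K) :
    (Fintype.card (HiggsLattice.Site P k) : ℝ) * 1 * ((P.L : ℝ) ^ k * P.ε) ^ P.d
      ≤ (Fintype.card (HiggsLattice.Site P P.K) : ℝ) * ((P.L : ℝ) ^ P.K * P.ε) ^ P.d := by
  have h1 := B1Ineq368BoxBound.card_site_zero_eq (P := P) hk
  have h2 := B1Ineq368BoxBound.card_site_zero_eq (P := P) (le_refl P.K)
  have e : ((P.L : ℝ) ^ (k * P.d)) * (Fintype.card (HiggsLattice.Site P k) : ℝ)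
      = (P.L : ℝ) ^ (P.K * P.d) * (Fintype.card (HiggsLattice.Site P P.K) : ℝ) := by
    exact_mod_cast h1.symm.trans h2
  apply le_of_eq
  calc (Fintype.card (HiggsLattice.Site P k) : ℝ) * 1 * ((P.L : ℝ) ^ k * P.ε) ^ P.d
      = ((P.L : ℝ) ^ (k * P.d) * (Fintype.card (HiggsLattice.Site P k) : ℝ)) * P.ε ^ P.d := by
        rw [mul_pow, ← pow_mul]; ring
    _ = ((P.L : ℝ) ^ (P.K * P.d) * (Fintype.card (HiggsLattice.Site P P.K) : ℝ)) * P.ε ^ P.d := by rw [e]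
    _ = (Fintype.card (HiggsLattice.Site P P.K) : ℝ) * ((P.L : ℝ) ^ P.K * P.ε) ^ P.d := by
        rw [mul_pow, ← pow_mul]; ring

/-! ## §5 (3.42) END TO END for the run of the constructed tower (p23's `B2Ineq342From346.ineq342_of_346_blocks` with
every geometric and combinatorial hypothesis DISCHARGED; what remains is the field side (3.46) and the per-scale (3.54)) -/

/-- **(3.42) for the run of the constructed tower**, `B2.Ineq342With Q (towerRun P Q F) (C₇ + C₅ + 1)`, END TO END in the
kernel from: the lattice geometry of part I §1 (`HiggsLattice`), the construction (2.7)–(2.8)/(2.55)/(2.43) of the regions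
from the large-field data (`B2Eq243RegionsTower`), the cube families (3.43)–(3.45) and the covering (3.48)–(3.52)
(`B2Eq345TowerCubes`, `B2Eq350TowerVolume`, `B2Eq352TowerVolumeBound`), the sequence count over all large-field data (p23's
`B2Ineq347SeqCount.entropy_of_blocks` with one site per block, `m = 1`, `θ = d + 1`), and the arithmetic (3.53)–(3.54)
(r14's `B2Sect3C.exponent_nonpos` inside p23's `ineq342_of_346`).  HYPOTHESES LEFT, all on the field side or on the constants:
`ζ″ ≥ 0` and the (3.46) shape `ζ″_{Λ₀^{(k)}} ≤ e^{a₆|Λ₀^{(k)c}|}e^{−c₀p(Lᵏε)²|𝒞_k|}` for the GIVEN `ζ″` (r14's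
`B2Eq341Zeta.zeta341_le` supplies it for every admissible-tuple dictionary), the printed parameter ranges with `R ≥ 1`,
`r ≥ 2` (cell GAPS G-pv04-2), the stopping rule in the form `Lᴷε ≤ 1`, and the per-scale condition (3.54) with
`O(1) = (a₆ + (d+1) + C₇ + C₅)(D₀ + D₇ + D₅)/(R log L)` (supplied by *"2p ≥ (d+1)r and ε₀ sufficiently small"*, §6).
[cite: Balaban1982Higgs2, (3.42) p.592, Sect. 3.C pp.592–594] -/
theorem ineq342 (hd : Q.d = P.d) (hLQ : Q.L = P.L) (hL1 : 1 < Q.L) (hR : 1 ≤ Q.R) (hr : 2 ≤ Q.r) (hκ : 0 ≤ Q.κ₀)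
    (hC₇ : 0 ≤ F.C₇) (hC₅ : 0 ≤ F.C₅) {a₆ : ℝ} (ha₆ : 0 ≤ a₆) (hK1 : (P.L : ℝ) ^ P.K * P.ε ≤ 1)
    (hz : ∀ (s : LFData P) (k : ℕ), k < P.K → 0 ≤ F.zeta k s)
    (h346 : ∀ (s : LFData P) (k : ℕ), k < P.K → F.zeta k s ≤ Real.exp (a₆ * ((((lam Q s k 0)ᶜ).card : ℕ) : ℝ)) *
        Real.exp (-(B2.c0 Q.a Q.γ₀ Q.d * B2.pFn Q.b₀ Q.p ((P.L : ℝ) ^ k * P.ε) ^ 2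
          * (((coverIn (dataOf s) (radius P Q) k).card : ℕ) : ℝ))))
    (hcond : ∀ k, k < P.K →
        (a₆ + ((Q.d : ℝ) + 1) + F.C₇ + F.C₅) * (D352 P Q.r 0 + D352 P Q.r 7 + D352 P Q.r 5)
            / (Q.R * Real.log (Q.L : ℝ)) * Q.R ^ (Q.d + 1)
          ≤ B2.c0 Q.a Q.γ₀ Q.d * Q.b₀ ^ 2 * B2Sect3C.xk Q (towerRun P Q F) k ^ (2 * Q.p - ((Q.d : ℝ) + 1) * Q.r)) :
    B2.Ineq342With Q (towerRun P Q F) (F.C₇ + F.C₅ + 1) := by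
  have hLP : 1 < (P.L : ℝ) := by rw [← hLQ]; exact_mod_cast hL1
  have hL2 : 2 ≤ (Q.L : ℝ) := by exact_mod_cast hL1
  have hR0 : 0 < Q.R := lt_of_lt_of_le zero_lt_one hR
  have hr0 : 0 ≤ Q.r := by linarith
  have hK1' : B2Sect3C.epsK Q (towerRun P Q F) (towerRun P Q F).K ≤ 1 := by
    rw [towerRun_K, epsK_towerRun hLQ]; exact hK1
  have hrad : ∀ k : Fin P.K, 0 < radius P Q k := fun k =>
    radius_pos hR hr0 hLP (mesh_le_one_of_le hLP.le k.isLt.le hK1)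
  have h := B2Ineq342From346.ineq342_of_346_blocks Q (towerRun P Q F) (towerCData P Q F)
    (a₆ := a₆) (θ := (Q.d : ℝ) + 1) (D := D352 P Q.r 0) (D₇ := D352 P Q.r 7) (D₅ := D352 P Q.r 5) (m := 1)
    (fun k : Fin P.K => HiggsLattice.Site P k) (fun (s : LFData P) (k : Fin P.K) => s k) (fun _ _ h => h)
    hL2 hR0 hr P.hε hK1' hκ hC₇ hC₅ ha₆ (by positivity) (D352_nonneg hLP _ 0) (D352_nonneg hLP _ 7)
    (D352_nonneg hLP _ 5) zero_lt_one (by rw [mul_one]) volTK_le_volT hz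
    (fun s k hk => by rw [epsK_towerRun hLQ]; exact h346 s k hk)
    (bound352 hd hLQ hR hr0 hLP hK1) (collar7 hd hLQ hR hr0 hLP hK1) (collar5 hd hLQ hR hr0 hLP hK1)
    vol7_K_le vol5_K_le (card_data_le_vol0c hrad)
    (fun k => by
      rw [epsK_towerRun hLQ, epsK_towerRun hLQ, hd]
      exact card_site_mul_mesh_pow k.isLt.le)
    hcond
  simpa only [towerRun_C₇, towerRun_C₅, div_one] using h

/-! ## §6 The claim of Sect. 3.C, `B2.Claim342Printed`, for the family of ALL constructed towers with the construction's
fixed integers `d`, `L`, `M` (r14's quantifier structure: threshold `ε₁`, then ONE constant for every run with `0 < ε ≤ ε₀`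
obeying the stopping rule), STRICT case `2p > (d+1)r` -/

/-- **An instance of the construction** for the parameters `Q` of Sect. 3.C and the block integer `M`: a torus of part I
(1.2) — any `ε`, `K`, `L′_μ` — with `d = Q.d`, `L = Q.L`, `M` fixed (p. 604: *"K, L, M, L′_μ are some positive integers"*;
`L`, `M` are the fixed integers of the procedure, `ε`, `K`, `L′_μ` vary with the run), and its field data.
[cite: Balaban1982Higgs2, (2.117) p.582, (3.42) p.592] -/
structure Instance (Q : B2.Params) (M : ℕ) : Type where
  /-- the lattice of the instance -/
  P : HiggsLattice.Params
  /-- its dimension is the `d` of `Q` -/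
  hd : Q.d = P.d
  /-- its scaling integer is the `L` of `Q` -/
  hL : Q.L = P.L
  /-- its block integer is `M` -/
  hM : P.M = M
  /-- the field data `ζ″`, `C₇`, `C₅` of the instance -/
  F : FieldData P

/-- **The family of runs of all constructed towers** (index: the instance; the stopping scale `ε₀` enters only through
the stopping rule, as in `B2.Claim342Printed`). [cite: Balaban1982Higgs2, (2.117) p.582, (3.42) p.592] -/
def fam (Q : B2.Params) (M : ℕ) : ℝ → Instance Q M → B2.Run := fun _ I => towerRun I.P Q I.F

/-- Unfolding of the family. [cite: Balaban1982Higgs2, (3.42) p.592] -/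
@[simp] theorem fam_apply (Q : B2.Params) (M : ℕ) (ε₀ : ℝ) (I : Instance Q M) : fam Q M ε₀ I = towerRun I.P Q I.F := rfl

/-- **The O(1)'s of (3.52) as functions of `d, L, M, r` alone** (uniform over the family): `D352 P r i` with the lattice's
`d, L, M` replaced by `Q.d, Q.L, M`. [cite: Balaban1982Higgs2, (3.52) p.594] -/
def Du (Q : B2.Params) (M : ℕ) (i : ℕ) : ℝ :=
  ((4 * max ((i : ℝ) + 1) 8 * S351 (Q.L : ℝ) Q.r * ((Q.L : ℝ) * M) + 1) * (1 + (Q.L : ℝ) * M)) ^ Q.d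

/-- For an instance, `D352 = Du`. [cite: Balaban1982Higgs2, (3.52) p.594] -/
theorem D352_eq_Du {M : ℕ} (I : Instance Q M) (i : ℕ) : D352 I.P Q.r i = Du Q M i := by
  unfold D352 Du coef352
  rw [← I.hL, ← I.hd, I.hM]

/-- `Du ≥ 0` (`L > 1`). [cite: Balaban1982Higgs2, (3.52) p.594] -/
theorem Du_nonneg (hL : 1 < (Q.L : ℝ)) (M i : ℕ) : 0 ≤ Du Q M i := by
  unfold Du
  have hS : 0 ≤ S351 (Q.L : ℝ) Q.r := zero_le_one.trans (one_le_S351 hL)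
  have hmax : 0 ≤ max ((i : ℝ) + 1) 8 := le_max_of_le_right (by norm_num)
  have hLM : 0 ≤ (Q.L : ℝ) * M := by positivity
  positivity

/-- **The claim of Sect. 3.C for the family of all constructed towers**: `B2.Claim342Printed Q (fam Q M)` — the decl of
record of SKELETON row B2.Eq3.42 INSTANTIATED and PROVED for the concrete (Higgs)₂,₃ tori, STRICT case `2p > (d+1)r` (*"ε₀
is sufficiently small"* = `ε₀ ≤ min{1, e^{1−x₀}}`, `x₀` from `B2.coeff354_threshold`; equality case: cell GAPS G-pv04-2),
GIVEN on the field side only: `ζ″ ≥ 0` with the (3.46) shape for the instances' `ζ″`, and the O(1)'s `0 ≤ C₇⁽ⁱ⁾ ≤ C₇`,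
`0 ≤ C₅⁽ⁱ⁾ ≤ C₅` bounded over the family (*"with the constant O(1) independent of ε"*, (2.117) p. 582).  The constant of
(3.42) is `C₇ + C₅ + 1`.  Assembly as in p23's `B2Ineq342From346.claim342_of_346` (threshold, `B2.logScale_ge`,
monotonicity of (3.42) in its constant), calling `ineq342` per instance. [cite: Balaban1982Higgs2, (3.42) p.592, Sect. 3.C pp.592–594, (2.117) p.582] -/
theorem claim342 {M : ℕ} (hP : Q.Printed) (hR : 1 ≤ Q.R) (hr : 2 ≤ Q.r) (hκ : 0 ≤ Q.κ₀)
    (hpr : ((Q.d : ℝ) + 1) * Q.r < 2 * Q.p) {a₆ C₇ C₅ : ℝ} (ha₆ : 0 ≤ a₆) (hC₇ : 0 ≤ C₇) (hC₅ : 0 ≤ C₅)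
    (hC : ∀ I : Instance Q M, 0 ≤ I.F.C₇ ∧ I.F.C₇ ≤ C₇ ∧ 0 ≤ I.F.C₅ ∧ I.F.C₅ ≤ C₅)
    (hz : ∀ (I : Instance Q M) (s : LFData I.P) (k : ℕ), k < I.P.K → 0 ≤ I.F.zeta k s)
    (h346 : ∀ (I : Instance Q M) (s : LFData I.P) (k : ℕ), k < I.P.K →
      I.F.zeta k s ≤ Real.exp (a₆ * ((((lam Q s k 0)ᶜ).card : ℕ) : ℝ)) *
        Real.exp (-(B2.c0 Q.a Q.γ₀ Q.d * B2.pFn Q.b₀ Q.p ((I.P.L : ℝ) ^ k * I.P.ε) ^ 2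
          * (((coverIn (dataOf s) (radius I.P Q) k).card : ℕ) : ℝ)))) :
    B2.Claim342Printed Q (fam Q M) := by
  intro _
  obtain ⟨_, _, hL1, _, ha, hγ, hb, hR0⟩ := hP
  have hL' : 1 < (Q.L : ℝ) := by exact_mod_cast hL1
  have hlogL : 0 < Real.log (Q.L : ℝ) := Real.log_pos hL'
  have hc : 0 < B2.c0 Q.a Q.γ₀ Q.d := B2Sect3C.c0_pos ha hγ Q.d
  have hDsum0 : 0 ≤ Du Q M 0 + Du Q M 7 + Du Q M 5 :=
    add_nonneg (add_nonneg (Du_nonneg hL' M 0) (Du_nonneg hL' M 7)) (Du_nonneg hL' M 5)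
  have hA0 : 0 ≤ a₆ + ((Q.d : ℝ) + 1) + C₇ + C₅ := by positivity
  have hC'0 : 0 ≤ (a₆ + ((Q.d : ℝ) + 1) + C₇ + C₅) * (Du Q M 0 + Du Q M 7 + Du Q M 5)
      / (Q.R * Real.log (Q.L : ℝ)) := by positivity
  obtain ⟨x₀, _, hx₀⟩ := B2.coeff354_threshold (d := Q.d) hc hb hC'0 hR0.le hpr
  refine ⟨min 1 (Real.exp (1 - x₀)), lt_min zero_lt_one (Real.exp_pos _), fun ε₀ hε₀ hε₀1 =>
    ⟨C₇ + C₅ + 1, ?_⟩⟩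
  intro I hε _ hstop
  have hε₀one : ε₀ ≤ 1 := le_trans hε₀1 (min_le_left _ _)
  have hK1 : (I.P.L : ℝ) ^ I.P.K * I.P.ε ≤ 1 := by
    have h : (Q.L : ℝ) ^ I.P.K * I.P.ε ≤ ε₀ := hstop.1
    rw [I.hL] at h
    exact h.trans hε₀one
  obtain ⟨h7₀, h7₁, h5₀, h5₁⟩ := hC I
  -- the per-scale (3.54) condition for this instance's constants (monotone in the O(1))
  have hcond : ∀ k, k < I.P.K →
      (a₆ + ((Q.d : ℝ) + 1) + I.F.C₇ + I.F.C₅) * (D352 I.P Q.r 0 + D352 I.P Q.r 7 + D352 I.P Q.r 5)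
          / (Q.R * Real.log (Q.L : ℝ)) * Q.R ^ (Q.d + 1)
        ≤ B2.c0 Q.a Q.γ₀ Q.d * Q.b₀ ^ 2
          * B2Sect3C.xk Q (towerRun I.P Q I.F) k ^ (2 * Q.p - ((Q.d : ℝ) + 1) * Q.r) := by
    intro k hk
    rw [D352_eq_Du I 0, D352_eq_Du I 7, D352_eq_Du I 5]
    have h1 : 1 + Real.log ε₀⁻¹ ≤ B2Sect3C.xk Q (towerRun I.P Q I.F) k :=
      B2.logScale_ge hL'.le hε hk hstop.1
    have h2 : x₀ ≤ 1 + Real.log ε₀⁻¹ := by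
      have : Real.log ε₀ ≤ 1 - x₀ := by
        have := Real.log_le_log hε₀ (le_trans hε₀1 (min_le_right _ _))
        rwa [Real.log_exp] at this
      rw [Real.log_inv]
      linarith
    have h3 := hx₀ _ (le_trans h2 h1)
    refine le_trans ?_ h3
    refine mul_le_mul_of_nonneg_right ?_ (pow_nonneg hR0.le _)
    refine div_le_div_of_nonneg_right ?_ (by positivity)
    exact mul_le_mul_of_nonneg_right (by linarith) hDsum0
  have h342 := ineq342 (P := I.P) (F := I.F) I.hd I.hL hL1 hR hr hκ h7₀ h5₀ ha₆ hK1 (hz I) (h346 I) hcond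
  -- monotonicity of (3.42) in its constant
  rw [fam_apply]
  unfold B2.Ineq342With at h342 ⊢
  refine le_trans h342 (Real.exp_le_exp.mpr ?_)
  exact mul_le_mul_of_nonneg_right (by linarith) (Nat.cast_nonneg _)

end Literature.MathematicalPhysics.QuantumFieldTheory.Balaban1983to89.B2Eq342TowerRun

end
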